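import Literature.Probability.LatticeModels.SixVertexTwoPointVertical

/-!
# Six-vertex model: Theorem 23, Step 2 completed — both pairs with vertical displacements
# (DKLM 2026, proof of Theorem 23, Step 2: "the general case is proved similarly")

H. Duminil-Copin, K. K. Kozlowski, P. Lammers, I. Manolescu, *Gaussian free field convergence of
the six-vertex model with `-1 ≤ Δ ≤ -1/2`*, arXiv:2603.06268 (2026) [DKLM2026SixVertexGFF]
(`paper:arxiv-2603.06268`, chunk p0044):

> We shall first relax the condition that `y₁ = 0`, and then the condition that `y₂ = 0`. In
> fact, the two proofs are the same […] This proves the case that `y₁ ≠ 0` and `y₂ = 0`; the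
> general case is proved similarly.

The mirror image of `SixVertexTwoPointVertical.lean` for the second pair: the strip of pair 2 is
widened by `n` columns on the right, the L-observable `h(u₂') - h(u₂)` is deformed on ice
configurations along `u₂ → u₂ + ne₁ → u₂' + ne₁ → u₂'` (`torusObs_lPairObs_shift_eq_of_ice`), the
middle piece is the L-observable moved `n` columns to the right — i.e. at gap `k + n` from pair 1
(`cylinderPairExp_right_shift`) — and dies by clustering and flip symmetry, while the two
horizontal pieces are given by Step 2 for the first pair (`cylinderPairExp_lPairObs_eq_sum`).

* `cylinderPairExp_widen_right` (extra columns on the right of strip 2 are not read),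
  `cylinderPairExp_right_shift` (moving the observable of pair 2 by `n` columns = increasing the
  gap by `n`);
* **`cylinderPairExp_lPairObs_lPairObs_eq_sum` — Theorem 23, formula (eq:thm23) for general
  horizontally ordered `u`** with both pairs L-shaped (`u_i' = u_i + (x_i, q_i)`, `x_i ≥ 1`):
  `Φ_{CYL_L,2}(u) = ∑_k w_k ((1-a_k)^{x₂} ω̄_k^{y₂+q₂} - ω̄_k^{y₂}) (1-a_k)^{x₁'} (ω_k^{y₀+q₁} - (1-a_k)^{x₁} ω_k^{y₀})`,
  the printed `∫ ((1-a)^{x₂}e^{-iby₂} - 1)(1-a)^{x₁'}e^{-iby₁'}(1 - (1-a)^{x₁}e^{-iby₁}) dμ_L(a,b)`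
  with `e^{-ib m} ↔ ω̄^m`, `e^{-iby₁'} = ω^{y(u₁')} ω̄^{y(u₂)}` (`|ω| = 1`).

## References

* H. Duminil-Copin, K. K. Kozlowski, P. Lammers, I. Manolescu, arXiv:2603.06268 (2026), Theorem 23
  and its proof, Step 2. [DKLM2026SixVertexGFF]
-/

noncomputable section

open Finset Matrix Filter Topology
open Literature.LinearAlgebra.Matrix

namespace Literature.Probability.LatticeModels.SixVertex

/-! ## 1. Widening strip 2 on the right and moving pair 2 to the right -/

section Right

variable {G₂ : Type*} [AddCommGroup G₂] [One G₂] [Fintype G₂] [DecidableEq G₂]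

/-- **Widening strip 2 on the right**: columns of strip 2 beyond the L-observable are not read.
[folklore] -/
theorem cylinderPairExp_widen_right (c : ℝ) {r₁' r₂' : ℕ}
    (X : (G₂ → Bool) → (Fin (r₁' + 1) → G₂ → Bool) → (Fin (r₁' + 1) → G₂ → Bool) → ℝ) (m : ℕ)
    (a w' : ℕ) (h : a + w' + 1 ≤ r₂' + 1) (q : ℕ) (y : G₂) (n : ℕ) :
    cylinderPairExp c r₁' X m (r₂' + n) (lPairObs (r₂' + n) a w' (by omega) q y) =
      cylinderPairExp c r₁' X m r₂' (lPairObs r₂' a w' h q y) :=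
  cylinderPairExp_congr c fun _ => rfl

/-- The same for a row block of pair 2. [folklore] -/
theorem cylinderPairExp_widen_right_rowBlockObs (c : ℝ) {r₁' r₂' : ℕ}
    (X : (G₂ → Bool) → (Fin (r₁' + 1) → G₂ → Bool) → (Fin (r₁' + 1) → G₂ → Bool) → ℝ) (m : ℕ)
    (a w' : ℕ) (h : a + w' + 1 ≤ r₂' + 1) (y : G₂) (n : ℕ) :
    cylinderPairExp c r₁' X m (r₂' + n) (rowBlockObs (r₂' + n) a w' (by omega) y) =
      cylinderPairExp c r₁' X m r₂' (rowBlockObs r₂' a w' h y) :=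
  cylinderPairExp_congr c fun _ => rfl

omit [One G₂] [Fintype G₂] [DecidableEq G₂] in
/-- Reading pair 2 at block start `a + n` is reading it at block start `a` after a gap increased by
`n`. [folklore] -/
theorem torusPairObs_right_shift {M : ℕ} {r₁' r₂' : ℕ}
    (X : (G₂ → Bool) → (Fin (r₁' + 1) → G₂ → Bool) → (Fin (r₁' + 1) → G₂ → Bool) → ℝ) (m : ℕ)
    (a w' : ℕ) (h : a + w' + 1 ≤ r₂' + 1) (q : ℕ) (y : G₂) (n : ℕ) [One G₂] (ω : Config (ZMod M × G₂)) :
    torusPairObs r₁' X m (r₂' + n) (lPairObs (r₂' + n) (a + n) w' (by omega) q y) ω =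
      torusPairObs r₁' X (m + n) r₂' (lPairObs r₂' a w' h q y) ω := by
  unfold torusPairObs
  rw [torusObs_lPairObs, torusObs_lPairObs]
  simp only [Prod.mk_add_mk, add_zero]
  have e1 : ∀ i : ℕ, (((a + n + i : ℕ) : ZMod M)) + ((m : ℕ) : ZMod M) =
      (((a + i : ℕ) : ZMod M)) + (((m + n : ℕ)) : ZMod M) := by
    intro i; push_cast; ring
  simp only [e1]

/-- **Moving pair 2 to the right by `n` columns increases the gap by `n`.** [folklore] -/
theorem cylinderPairExp_right_shift (c : ℝ) {r₁' r₂' : ℕ}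
    (X : (G₂ → Bool) → (Fin (r₁' + 1) → G₂ → Bool) → (Fin (r₁' + 1) → G₂ → Bool) → ℝ) (m : ℕ)
    (a w' : ℕ) (h : a + w' + 1 ≤ r₂' + 1) (q : ℕ) (y : G₂) (n : ℕ) :
    cylinderPairExp c r₁' X m (r₂' + n) (lPairObs (r₂' + n) (a + n) w' (by omega) q y) =
      cylinderPairExp c r₁' X (m + n) r₂' (lPairObs r₂' a w' h q y) := by
  refine cylinderPairExp_congr c fun M => ?_
  unfold torusPairExp
  split_ifs with hM
  · rfl
  · rw [funext fun ω => torusPairObs_right_shift X m a w' h q y n ω]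

end Right

/-! ## 2. Theorem 23 for general horizontally ordered pairs -/

section General

variable (c : ℝ) (hc : 0 < c) (ℓ : ℕ)

include hc

/-- **Theorem 23 (spectral representation of the two-point function), general horizontally
ordered `u`.** For `c > 0`, `L = 2(ℓ+1)`, pair 1 the L-shaped difference with
`u₁' = u₁ + (x₁, q₁)`, `x₁ = w₁'+1`, rows `y₀ → y₀ + q₁`, pair 2 the L-shaped difference with
`u₂' = u₂ + (x₂, q₂)`, `x₂ = w₂'+1`, rows `y₂ → y₂ + q₂`, at horizontal distance
`x₁' = (r₁' - a₁ - w₁') + k + a₂ ≥ 0`: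
`Φ_{CYL_L,2}(u) = ∑_k w_k ((1-a_k)^{x₂} ω̄_k^{y₂+q₂} - ω̄_k^{y₂}) (1-a_k)^{x₁'} (ω_k^{y₀+q₁} - (1-a_k)^{x₁} ω_k^{y₀})`
`= ∫ ((1-a)^{x₂}e^{-iby₂} - 1)(1-a)^{x₁'}e^{-iby₁'}(1 - (1-a)^{x₁}e^{-iby₁}) dμ_L(a,b)` with the
positive finite measure `μ_L = ∑_k w_k δ_{(a_k, arg ω_k)}` (`dklmWeight`, `dklmAtomA`,
`transferJointPhase`), supported on `(0,2) × (2π/L)ℤ`.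
[cite: DKLM2026SixVertexGFF, Theorem 23 and its proof, Steps 1–2] -/
theorem cylinderPairExp_lPairObs_lPairObs_eq_sum {r₁' r₂' : ℕ} (a₁ w₁' : ℕ) (h₁ : a₁ + w₁' + 1 ≤ r₁' + 1)
    (q₁ : ℕ) (a₂ w₂' : ℕ) (h₂ : a₂ + w₂' + 1 ≤ r₂' + 1) (q₂ : ℕ) (y₀ y₂ k : ℕ) :
    ((cylinderPairExp c r₁' (lPairObs r₁' a₁ w₁' h₁ q₁ ((y₀ : ℕ) : ZMod (2 * (ℓ + 1)))) (r₁' + 1 + k) r₂'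
        (lPairObs r₂' a₂ w₂' h₂ q₂ ((y₂ : ℕ) : ZMod (2 * (ℓ + 1)))) : ℝ) : ℂ) =
      ∑ j, (dklmWeight c hc ℓ j : ℂ) *
        ((1 - (dklmAtomA c ℓ j : ℂ)) ^ (w₂' + 1) * star (transferJointPhase c ℓ j) ^ (y₂ + q₂) -
          star (transferJointPhase c ℓ j) ^ y₂) *
        (1 - (dklmAtomA c ℓ j : ℂ)) ^ ((r₁' - a₁ - w₁') + k + a₂) *
        (transferJointPhase c ℓ j ^ (y₀ + q₁) - (1 - (dklmAtomA c ℓ j : ℂ)) ^ (w₁' + 1) * transferJointPhase c ℓ j ^ y₀) := by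
  -- abbreviation-free but readable: `X` = pair 1, everything at `L = 2(ℓ+1)`
  have hdecomp : ∀ n' : ℕ,
      cylinderPairExp c r₁' (lPairObs r₁' a₁ w₁' h₁ q₁ ((y₀ : ℕ) : ZMod (2 * (ℓ + 1)))) (r₁' + 1 + k) r₂'
          (lPairObs r₂' a₂ w₂' h₂ q₂ ((y₂ : ℕ) : ZMod (2 * (ℓ + 1)))) =
        cylinderPairExp c r₁' (lPairObs r₁' a₁ w₁' h₁ q₁ ((y₀ : ℕ) : ZMod (2 * (ℓ + 1)))) (r₁' + 1 + k) (r₂' + (n' + 1))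
            (rowBlockObs (r₂' + (n' + 1)) a₂ n' (by omega) ((y₂ : ℕ) : ZMod (2 * (ℓ + 1)))) +
          cylinderPairExp c r₁' (lPairObs r₁' a₁ w₁' h₁ q₁ ((y₀ : ℕ) : ZMod (2 * (ℓ + 1)))) (r₁' + 1 + k + (n' + 1)) r₂'
            (lPairObs r₂' a₂ w₂' h₂ q₂ ((y₂ : ℕ) : ZMod (2 * (ℓ + 1)))) -
          cylinderPairExp c r₁' (lPairObs r₁' a₁ w₁' h₁ q₁ ((y₀ : ℕ) : ZMod (2 * (ℓ + 1)))) (r₁' + 1 + k) (r₂' + (n' + 1))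
            (rowBlockObs (r₂' + (n' + 1)) (a₂ + w₂' + 1) n' (by omega)
              (((y₂ : ℕ) : ZMod (2 * (ℓ + 1))) + q₂ • (1 : ZMod (2 * (ℓ + 1))))) := by
    intro n'
    -- pair 2 in the widened strip: deform `L(a₂) = A₂ + L(a₂ + n) - C₂` on ice configurations
    have hice : cylinderPairExp c r₁' (lPairObs r₁' a₁ w₁' h₁ q₁ ((y₀ : ℕ) : ZMod (2 * (ℓ + 1)))) (r₁' + 1 + k)
        (r₂' + (n' + 1)) (lPairObs (r₂' + (n' + 1)) a₂ w₂' (by omega) q₂ ((y₂ : ℕ) : ZMod (2 * (ℓ + 1)))) =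
        cylinderPairExp c r₁' (lPairObs r₁' a₁ w₁' h₁ q₁ ((y₀ : ℕ) : ZMod (2 * (ℓ + 1)))) (r₁' + 1 + k) (r₂' + (n' + 1))
          (rowBlockObs (r₂' + (n' + 1)) a₂ n' (by omega) ((y₂ : ℕ) : ZMod (2 * (ℓ + 1))) +
            lPairObs (r₂' + (n' + 1)) (a₂ + (n' + 1)) w₂' (by omega) q₂ ((y₂ : ℕ) : ZMod (2 * (ℓ + 1))) +
            (-1 : ℝ) • rowBlockObs (r₂' + (n' + 1)) (a₂ + w₂' + 1) n' (by omega)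
              (((y₂ : ℕ) : ZMod (2 * (ℓ + 1))) + q₂ • (1 : ZMod (2 * (ℓ + 1))))) := by
      refine cylinderPairExp_congr c fun M => ?_
      unfold torusPairExp
      split_ifs with hM
      · rfl
      · haveI : NeZero M := ⟨hM⟩
        refine torusCondExp_congr_of_ice 1 1 c fun ω hω => ?_
        unfold torusPairObs
        congr 1
        have hω' : ∀ v, IceRuleAt (fun w : ZMod M × ZMod (2 * (ℓ + 1)) => ω (w + ((((r₁' + 1 + k : ℕ)) : ZMod M), 0))) v := by
          intro v
          have ht1 : ((v.1 - 1, v.2) : ZMod M × ZMod (2 * (ℓ + 1))) + ((((r₁' + 1 + k : ℕ)) : ZMod M), 0) =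
              ((v + ((((r₁' + 1 + k : ℕ)) : ZMod M), 0)).1 - 1, (v + ((((r₁' + 1 + k : ℕ)) : ZMod M), 0)).2) :=
            Prod.ext (sub_add_eq_add_sub _ _ _) rfl
          have ht2 : ((v.1, v.2 - 1) : ZMod M × ZMod (2 * (ℓ + 1))) + ((((r₁' + 1 + k : ℕ)) : ZMod M), 0) =
              ((v + ((((r₁' + 1 + k : ℕ)) : ZMod M), 0)).1, (v + ((((r₁' + 1 + k : ℕ)) : ZMod M), 0)).2 - 1) :=
            Prod.ext rfl (sub_add_eq_add_sub _ _ _)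
          unfold IceRuleAt
          rw [inDegree_congr (ω' := fun w : ZMod M × ZMod (2 * (ℓ + 1)) => ω (w + ((((r₁' + 1 + k : ℕ)) : ZMod M), 0)))
            (v' := v) (ω := ω) (v := v + ((((r₁' + 1 + k : ℕ)) : ZMod M), 0)) rfl (congrArg ω ht1) (congrArg ω ht2)]
          exact hω _
        have hdef := torusObs_lPairObs_shift_eq_of_ice r₂' a₂ w₂' n' h₂ q₂ ((y₂ : ℕ) : ZMod (2 * (ℓ + 1))) _ hω'
        show torusObs (r₂' + (n' + 1)) (lPairObs (r₂' + (n' + 1)) a₂ w₂' (by omega) q₂ ((y₂ : ℕ) : ZMod (2 * (ℓ + 1))))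
            (fun w : ZMod M × ZMod (2 * (ℓ + 1)) => ω (w + ((((r₁' + 1 + k : ℕ)) : ZMod M), 0))) =
          torusObs (r₂' + (n' + 1)) (rowBlockObs (r₂' + (n' + 1)) a₂ n' (by omega) ((y₂ : ℕ) : ZMod (2 * (ℓ + 1))))
            (fun w : ZMod M × ZMod (2 * (ℓ + 1)) => ω (w + ((((r₁' + 1 + k : ℕ)) : ZMod M), 0))) +
          torusObs (r₂' + (n' + 1)) (lPairObs (r₂' + (n' + 1)) (a₂ + (n' + 1)) w₂' (by omega) q₂ ((y₂ : ℕ) : ZMod (2 * (ℓ + 1))))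
            (fun w : ZMod M × ZMod (2 * (ℓ + 1)) => ω (w + ((((r₁' + 1 + k : ℕ)) : ZMod M), 0))) +
          (-1 : ℝ) * torusObs (r₂' + (n' + 1)) (rowBlockObs (r₂' + (n' + 1)) (a₂ + w₂' + 1) n' (by omega)
            (((y₂ : ℕ) : ZMod (2 * (ℓ + 1))) + q₂ • (1 : ZMod (2 * (ℓ + 1)))))
            (fun w : ZMod M × ZMod (2 * (ℓ + 1)) => ω (w + ((((r₁' + 1 + k : ℕ)) : ZMod M), 0)))
        rw [hdef]
        ring
    rw [← cylinderPairExp_widen_right c _ (r₁' + 1 + k) a₂ w₂' h₂ q₂ ((y₂ : ℕ) : ZMod (2 * (ℓ + 1))) (n' + 1), hice,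
      cylinderPairExp_add_right c hc, cylinderPairExp_add_right c hc, cylinderPairExp_smul_right c hc,
      cylinderPairExp_right_shift c _ (r₁' + 1 + k) a₂ w₂' h₂ q₂ ((y₂ : ℕ) : ZMod (2 * (ℓ + 1))) (n' + 1)]
    ring
  -- (a) the error term → 0 by clustering and flip symmetry
  have hM : Tendsto (fun n' : ℕ => cylinderPairExp c r₁' (lPairObs r₁' a₁ w₁' h₁ q₁ ((y₀ : ℕ) : ZMod (2 * (ℓ + 1))))
      (r₁' + 1 + k + (n' + 1)) r₂' (lPairObs r₂' a₂ w₂' h₂ q₂ ((y₂ : ℕ) : ZMod (2 * (ℓ + 1))))) atTop (𝓝 0) := by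
    have h := (tendsto_cylinderPairExp_atTop c hc ℓ (lPairObs r₁' a₁ w₁' h₁ q₁ ((y₀ : ℕ) : ZMod (2 * (ℓ + 1))))
      (lPairObs r₂' a₂ w₂' h₂ q₂ ((y₂ : ℕ) : ZMod (2 * (ℓ + 1))))).comp
      ((tendsto_add_atTop_nat k).comp (tendsto_add_atTop_nat 1))
    rw [cylinderObsExp_eq_zero_of_isFlipOdd c (isFlipOdd_lPairObs r₁' a₁ w₁' h₁ q₁ _), zero_mul] at h
    refine h.congr fun n' => ?_
    simp only [Function.comp_apply]
    rw [show r₁' + 1 + (n' + 1 + k) = r₁' + 1 + k + (n' + 1) by omega]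
  -- (b) the two horizontal pieces of pair 2 via Step 2 for pair 1
  have hA : ∀ n' : ℕ, ((cylinderPairExp c r₁' (lPairObs r₁' a₁ w₁' h₁ q₁ ((y₀ : ℕ) : ZMod (2 * (ℓ + 1)))) (r₁' + 1 + k)
      (r₂' + (n' + 1)) (rowBlockObs (r₂' + (n' + 1)) a₂ n' (by omega) ((y₂ : ℕ) : ZMod (2 * (ℓ + 1)))) : ℝ) : ℂ) =
      ∑ j, (dklmWeight c hc ℓ j : ℂ) * ((1 - (dklmAtomA c ℓ j : ℂ)) ^ (n' + 1) - 1) *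
        (1 - (dklmAtomA c ℓ j : ℂ)) ^ ((r₁' - a₁ - w₁') + k + a₂) * star (transferJointPhase c ℓ j) ^ y₂ *
        (transferJointPhase c ℓ j ^ (y₀ + q₁) - (1 - (dklmAtomA c ℓ j : ℂ)) ^ (w₁' + 1) * transferJointPhase c ℓ j ^ y₀) :=
    fun n' => cylinderPairExp_lPairObs_eq_sum c hc ℓ a₁ w₁' h₁ q₁ a₂ n' (by omega) y₀ y₂ k
  have hC : ∀ n' : ℕ, ((cylinderPairExp c r₁' (lPairObs r₁' a₁ w₁' h₁ q₁ ((y₀ : ℕ) : ZMod (2 * (ℓ + 1)))) (r₁' + 1 + k)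
      (r₂' + (n' + 1)) (rowBlockObs (r₂' + (n' + 1)) (a₂ + w₂' + 1) n' (by omega)
        (((y₂ : ℕ) : ZMod (2 * (ℓ + 1))) + q₂ • (1 : ZMod (2 * (ℓ + 1))))) : ℝ) : ℂ) =
      ∑ j, (dklmWeight c hc ℓ j : ℂ) * ((1 - (dklmAtomA c ℓ j : ℂ)) ^ (n' + 1) - 1) *
        (1 - (dklmAtomA c ℓ j : ℂ)) ^ ((r₁' - a₁ - w₁') + k + (a₂ + w₂' + 1)) * star (transferJointPhase c ℓ j) ^ (y₂ + q₂) *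
        (transferJointPhase c ℓ j ^ (y₀ + q₁) - (1 - (dklmAtomA c ℓ j : ℂ)) ^ (w₁' + 1) * transferJointPhase c ℓ j ^ y₀) := by
    intro n'
    have h := cylinderPairExp_lPairObs_eq_sum c hc ℓ (r₂' := r₂' + (n' + 1)) a₁ w₁' h₁ q₁ (a₂ + w₂' + 1) n' (by omega)
      y₀ (y₂ + q₂) k
    rw [show (((y₂ + q₂ : ℕ)) : ZMod (2 * (ℓ + 1))) = ((y₂ : ℕ) : ZMod (2 * (ℓ + 1))) + q₂ • (1 : ZMod (2 * (ℓ + 1))) by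
      rw [nsmul_one]; push_cast; ring] at h
    exact h
  -- the constant sequence equals its limit
  have hconst : Tendsto (fun _ : ℕ => ((cylinderPairExp c r₁' (lPairObs r₁' a₁ w₁' h₁ q₁ ((y₀ : ℕ) : ZMod (2 * (ℓ + 1))))
      (r₁' + 1 + k) r₂' (lPairObs r₂' a₂ w₂' h₂ q₂ ((y₂ : ℕ) : ZMod (2 * (ℓ + 1)))) : ℝ) : ℂ)) atTop
      (𝓝 (∑ j, (dklmWeight c hc ℓ j : ℂ) *
        ((1 - (dklmAtomA c ℓ j : ℂ)) ^ (w₂' + 1) * star (transferJointPhase c ℓ j) ^ (y₂ + q₂) -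
          star (transferJointPhase c ℓ j) ^ y₂) *
        (1 - (dklmAtomA c ℓ j : ℂ)) ^ ((r₁' - a₁ - w₁') + k + a₂) *
        (transferJointPhase c ℓ j ^ (y₀ + q₁) - (1 - (dklmAtomA c ℓ j : ℂ)) ^ (w₁' + 1) * transferJointPhase c ℓ j ^ y₀))) := by
    have hseq : (fun _ : ℕ => ((cylinderPairExp c r₁' (lPairObs r₁' a₁ w₁' h₁ q₁ ((y₀ : ℕ) : ZMod (2 * (ℓ + 1))))
        (r₁' + 1 + k) r₂' (lPairObs r₂' a₂ w₂' h₂ q₂ ((y₂ : ℕ) : ZMod (2 * (ℓ + 1)))) : ℝ) : ℂ)) = fun n' : ℕ =>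
        (∑ j, (dklmWeight c hc ℓ j : ℂ) * ((1 - (dklmAtomA c ℓ j : ℂ)) ^ (n' + 1) - 1) *
            (1 - (dklmAtomA c ℓ j : ℂ)) ^ ((r₁' - a₁ - w₁') + k + a₂) *
            (star (transferJointPhase c ℓ j) ^ y₂ *
              (transferJointPhase c ℓ j ^ (y₀ + q₁) - (1 - (dklmAtomA c ℓ j : ℂ)) ^ (w₁' + 1) * transferJointPhase c ℓ j ^ y₀))) +
          ((cylinderPairExp c r₁' (lPairObs r₁' a₁ w₁' h₁ q₁ ((y₀ : ℕ) : ZMod (2 * (ℓ + 1))))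
            (r₁' + 1 + k + (n' + 1)) r₂' (lPairObs r₂' a₂ w₂' h₂ q₂ ((y₂ : ℕ) : ZMod (2 * (ℓ + 1)))) : ℝ) : ℂ) -
          ∑ j, (dklmWeight c hc ℓ j : ℂ) * ((1 - (dklmAtomA c ℓ j : ℂ)) ^ (n' + 1) - 1) *
            (1 - (dklmAtomA c ℓ j : ℂ)) ^ ((r₁' - a₁ - w₁') + k + (a₂ + w₂' + 1)) *
            (star (transferJointPhase c ℓ j) ^ (y₂ + q₂) *
              (transferJointPhase c ℓ j ^ (y₀ + q₁) - (1 - (dklmAtomA c ℓ j : ℂ)) ^ (w₁' + 1) * transferJointPhase c ℓ j ^ y₀)) := by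
      funext n'
      rw [hdecomp n', Complex.ofReal_sub, Complex.ofReal_add, hA n', hC n',
        Finset.sum_congr rfl fun j _ => show (dklmWeight c hc ℓ j : ℂ) * ((1 - (dklmAtomA c ℓ j : ℂ)) ^ (n' + 1) - 1) *
            (1 - (dklmAtomA c ℓ j : ℂ)) ^ ((r₁' - a₁ - w₁') + k + a₂) * star (transferJointPhase c ℓ j) ^ y₂ *
            (transferJointPhase c ℓ j ^ (y₀ + q₁) - (1 - (dklmAtomA c ℓ j : ℂ)) ^ (w₁' + 1) * transferJointPhase c ℓ j ^ y₀) =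
          (dklmWeight c hc ℓ j : ℂ) * ((1 - (dklmAtomA c ℓ j : ℂ)) ^ (n' + 1) - 1) *
            (1 - (dklmAtomA c ℓ j : ℂ)) ^ ((r₁' - a₁ - w₁') + k + a₂) *
            (star (transferJointPhase c ℓ j) ^ y₂ *
              (transferJointPhase c ℓ j ^ (y₀ + q₁) - (1 - (dklmAtomA c ℓ j : ℂ)) ^ (w₁' + 1) * transferJointPhase c ℓ j ^ y₀))
          by ring,
        Finset.sum_congr rfl fun j _ => show (dklmWeight c hc ℓ j : ℂ) * ((1 - (dklmAtomA c ℓ j : ℂ)) ^ (n' + 1) - 1) *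
            (1 - (dklmAtomA c ℓ j : ℂ)) ^ ((r₁' - a₁ - w₁') + k + (a₂ + w₂' + 1)) * star (transferJointPhase c ℓ j) ^ (y₂ + q₂) *
            (transferJointPhase c ℓ j ^ (y₀ + q₁) - (1 - (dklmAtomA c ℓ j : ℂ)) ^ (w₁' + 1) * transferJointPhase c ℓ j ^ y₀) =
          (dklmWeight c hc ℓ j : ℂ) * ((1 - (dklmAtomA c ℓ j : ℂ)) ^ (n' + 1) - 1) *
            (1 - (dklmAtomA c ℓ j : ℂ)) ^ ((r₁' - a₁ - w₁') + k + (a₂ + w₂' + 1)) *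
            (star (transferJointPhase c ℓ j) ^ (y₂ + q₂) *
              (transferJointPhase c ℓ j ^ (y₀ + q₁) - (1 - (dklmAtomA c ℓ j : ℂ)) ^ (w₁' + 1) * transferJointPhase c ℓ j ^ y₀))
          by ring]
    rw [hseq]
    -- termwise limits: `w_j (1-a_j)^{n'+1} → 0`
    have hlim : ∀ (e : ℕ) (P : {κ : ZMod (2 * (ℓ + 1)) → Bool // IsBalancedCol κ} → ℂ),
        Tendsto (fun n' : ℕ => ∑ j, (dklmWeight c hc ℓ j : ℂ) * ((1 - (dklmAtomA c ℓ j : ℂ)) ^ (n' + 1) - 1) *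
          (1 - (dklmAtomA c ℓ j : ℂ)) ^ e * P j) atTop
          (𝓝 (∑ j, (dklmWeight c hc ℓ j : ℂ) * (0 - 1) * (1 - (dklmAtomA c ℓ j : ℂ)) ^ e * P j)) := by
      intro e P
      refine tendsto_finsetSum _ fun j _ => ?_
      have hw := (tendsto_dklmWeight_mul_pow c hc ℓ j).comp (tendsto_add_atTop_nat 1)
      have h2 : Tendsto (fun n' : ℕ => ((dklmWeight c hc ℓ j : ℂ) * (1 - (dklmAtomA c ℓ j : ℂ)) ^ (n' + 1)) *
          ((1 - (dklmAtomA c ℓ j : ℂ)) ^ e * P j) - (dklmWeight c hc ℓ j : ℂ) * ((1 - (dklmAtomA c ℓ j : ℂ)) ^ e * P j))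
          atTop (𝓝 (0 * _ - _)) := (hw.mul_const _).sub tendsto_const_nhds
      refine (h2.congr fun n' => ?_).trans ?_
      · ring
      · exact le_of_eq (by congr 1; ring)
    have hMc : Tendsto (fun n' : ℕ => ((cylinderPairExp c r₁' (lPairObs r₁' a₁ w₁' h₁ q₁ ((y₀ : ℕ) : ZMod (2 * (ℓ + 1))))
        (r₁' + 1 + k + (n' + 1)) r₂' (lPairObs r₂' a₂ w₂' h₂ q₂ ((y₂ : ℕ) : ZMod (2 * (ℓ + 1)))) : ℝ) : ℂ)) atTop (𝓝 0) := by
      have h := (Complex.continuous_ofReal.tendsto _).comp hM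
      rwa [Complex.ofReal_zero] at h
    have htot := ((hlim ((r₁' - a₁ - w₁') + k + a₂) (fun j => star (transferJointPhase c ℓ j) ^ y₂ *
        (transferJointPhase c ℓ j ^ (y₀ + q₁) - (1 - (dklmAtomA c ℓ j : ℂ)) ^ (w₁' + 1) * transferJointPhase c ℓ j ^ y₀))).add hMc).sub
      (hlim ((r₁' - a₁ - w₁') + k + (a₂ + w₂' + 1)) (fun j => star (transferJointPhase c ℓ j) ^ (y₂ + q₂) *
        (transferJointPhase c ℓ j ^ (y₀ + q₁) - (1 - (dklmAtomA c ℓ j : ℂ)) ^ (w₁' + 1) * transferJointPhase c ℓ j ^ y₀)))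
    convert htot using 2
    · rw [add_zero, ← Finset.sum_sub_distrib]
      refine Finset.sum_congr rfl fun j _ => ?_
      rw [pow_add, pow_add, pow_add]
      ring
  exact tendsto_nhds_unique tendsto_const_nhds hconst

end General

end Literature.Probability.LatticeModels.SixVertex

end
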